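import Summits.Ventures.CertifiedManyBodySolver.Observables.MeanFieldClassExclusionLaLowU
import Literature.MathematicalPhysics.QuantumLattice.HubbardFermiSeaTangentRows
import Literature.MathematicalPhysics.QuantumLattice.HubbardFermiSeaTangentRowsDeepColumns
import HarnessLib

/-!
# Ventures/CertifiedManyBodySolver — Observables/MeanFieldClassExclusionObjectEYbco.lean

HONEST FRAMING: first certified bounds; not a superconductivity verdict; every number certified or labelled float.
A competing-order EXCLUSION removes a named class of candidate ground states; it never says which order is present;
no phase sentence follows.

Cell `hubbard-tc` (MO-S3, D-0096), seat `hubbard-tc-mod-3` (G3: competing orders as exclusion inputs from certified energy ORDERINGS),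
`prover-hubbard-tc-mod-3-g5-0`. The MF/BCS-class word for **YBa₂Cu₃O₆.₉₂ (VSET M18, V-003)** on the CuO₂-PLANE LIT-PREVIEW box of the S1 router
(`BOXES/YBa2Cu3O7.md` v1.1 ADDENDUM, the box the cell's kinematic row C5(E-LP) / p1 `ybcoBoxLP_*` use: plane `t′/t ∈ [−0.33, −0.22]` (ALJP95 §7 hull
± FLOOR), `n(plane) ∈ [0.82, 0.86]` (p ≈ 0.16 ± 0.02), `t″` and the intra-bilayer `t⊥` DROPPED — they are not coordinates of the `t–t′` object; `U/t` is a
CLASS PROXY: reading (B) all admissible one-band schemes `[5.1, 14.3]`, reading (A) MACE apical-O class `[9.1, 14.3]`; no YBCO one-band `U` in print):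

  `t′ ∈ [−33/100, −11/50]`, `n ∈ [41/50, 43/50]`, EVERY `U ≥ 5.5`  ⇒  `Re ω(n_{0↑} n_{0↓}) < (n/2)²`  (`ybcoE_plane_docc_lt_of`)

for every torus limit `ω` of unit `(rectN n L, S^z = 0)`-sector ground states of `hubbardTorusTT' L 1 t′ U` — no non-magnetic Hartree–Fock / singlet-BCS
ground state (Wick; the identification is the docstring's reading, the THEOREM is the strict docc inequality). Covers reading (A) WHOLE and reading (B)
on `[5.5, 14.3]` (sliver `[5.1, 5.5)` «undetermined-MF»: exact margin `−0.037` at `5.1`, `+0.030` at `5.5`). The La word `laLow_x015_docc_lt_of`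
(`t′ ∈ [−0.30, −0.20]`, `n ∈ [0.83, 0.87]`, `U ≥ 5.9`) already covered most of this face; the present theorem extends it to the YBCO corners
(`t′` down to `−0.33`, `n` down to `0.82`) and lowers the threshold with the `t′`-chord cap.

Proof = devices of `MeanFieldClassExclusionLaLowU.lean` / `…ObjectE.lean`, no new mathematics: CAP at `U_c = 8` = the density chord `1/2 → 7/8`
(`laLow_chord_half_78`, convexity in `n`) between the CERTIFIED #498 quarter-filling cap transported in `t′` (`laLow_quarter_cap`) and the `7/8` anchor —
the `t′`-CHORD cap `objE_conc78_cap8` (CERTIFIED #473 floor ∧ #445 cap) on `t′ ≤ −1/4`, the near-side kinematic transport of #445 (`laLow_cap78_near`) on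
`t′ ≥ −1/4`; FLOOR at `U₀ = 0` = kernel tangent Fermi-sea rows `−7/20 @ 4/5`, `−3/10 @ 21/25`, `−1/4 @ 17/20`, `−1/5 @ 17/20` read between columns by
concavity (`objE_floor_between`); TAIL = `doccN_lt_of_capUc_threshold` (`U₁ = 11/2 ≤ U_c = 8`; `(n/2)²` above its tangent at `n = 41/50`); the
bilinear `(n, t′)` chord terms are closed by `nlinarith` with the four McCormick products of each leaf rectangle (corner-exact). Exact leaf margins
(designer `hubbard-tc-mod-3/g5-replay/ybco/ybco_design.py`): `+0.0298` (`[−7/20, −3/10]`), `+0.0450` (`[−3/10, −1/4]`), `+0.0376` (`[−1/4, −11/50]`).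
Conditional on the claim nodes #498 ∧ #445 ∧ #473 BY HYPOTHESIS. WHAT THIS IS NOT: a statement about the bilayer, the chains, `t″`, stripes/CDW in
YBCO, d-wave order or T_c; the saturated-FM class; tight; a phase word.

References: T. Koma, H. Tasaki, J. Stat. Phys. 76 (1994) 745, §1 [KomaTasaki1994]; V. Bach, E. H. Lieb, J. P. Solovej, J. Stat. Phys. 76 (1994) 3,
eq. (2c.36) [BachLiebSolovej1994]; E. H. Lieb, M. Loss, Duke Math. J. 71 (1993) 337, §8 Thm 8.2 [LiebLoss1993]; R. B. Israel, Convexity in the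
Theory of Lattice Gases (1979), Thm I.3.4 [Israel1979]; D. Ruelle, Statistical Mechanics (1969) §3.3 [Ruelle1969].
-/

noncomputable section

namespace Summit.Ventures.CertifiedManyBodySolver.Observables

open Literature.MathematicalPhysics.QuantumLattice
open Literature.MathematicalPhysics.QuantumLattice.ThermodynamicLimit
open Summit.Ventures.CertifiedManyBodySolver.Certificates
open Matrix HubbardWave0 Literature.Probability.LatticeModels Filter Topology
open scoped ComplexOrder BigOperators

/-- **YBa₂Cu₃O₆.₉₂ (VSET M18), CuO₂-plane LIT-PREVIEW face `t′ ∈ [−33/100, −11/50]` × `n ∈ [41/50, 43/50]` — MF/BCS class excluded at EVERY `U ≥ 5.5`**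
(reading (A) `[9.1, 14.3]` whole, reading (B) `[5.1, 14.3]` from `5.5`): assume the claim nodes #498, #445, #473; then every GS torus limit has
`Re ω(n_{0↑}n_{0↓}) < (n/2)²`. Cap at `U_c = 8` = chord `1/2 → 7/8` (transported #498; `t′`-chord cap #473 ∧ #445 on `t′ ≤ −1/4`, near-side #445 beyond);
floor = tangent rows `−7/20@4/5`, `−3/10@21/25`, `−1/4@17/20`, `−1/5@17/20`; three pieces; smallest exact margin `+0.0298`.
[cite: KomaTasaki1994, §1] [cite: BachLiebSolovej1994, eq. (2c.36)] [cite: LiebLoss1993, §8, Theorem 8.2] -/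
theorem ybcoE_plane_docc_lt_of (h498 : cert_r498_qfp_U8_n1o2_tp0_upper) (h445 : cert_dbt329pair_allk)
    (h473 : cert_r473_bs_M3U8tp0_w3_b4_R2_ob5p2_kry1_kry2c3rel_hanK7B4D4_KN4_PR20d4_hanK8c2s_hanK8B4D4_uprime)
    {t' U n : ℝ} (ht1 : -33 / 100 ≤ t') (ht2 : t' ≤ -11 / 50) (hU : 11 / 2 ≤ U)
    (hn1 : 41 / 50 ≤ n) (hn2 : n ≤ 43 / 50) :
    ∀ (ω : InfVolFermionState 2) (Ls : ℕ → ℕ) (ψ : ∀ L, Fock (Orb (FermionTorus 2 L))),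
      Tendsto Ls atTop atTop →
      (∀ j, IsGroundStateInSector (hubbardTorusTT' (Ls j) 1 t' U) (rectN n (Ls j)) 0 (ψ (Ls j))) →
      (∀ j, star (ψ (Ls j)) ⬝ᵥ ψ (Ls j) = 1) → ω.IsTorusLimitOf ψ Ls →
      (ω.expect ({0} : Finset (Site 2))
        (nAt 0 (Finset.mem_singleton_self 0) 0 * nAt 0 (Finset.mem_singleton_self 0) 1)).re < (n / 2) ^ 2 := by
  have hn0 : (0 : ℝ) ≤ n := by linarith
  have hn2' : n < 2 := by linarith
  have hhalf : (1 / 2 : ℝ) < n := by linarith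
  have h78 : n < 7 / 8 := by linarith
  -- the class constant `(n/2)²` above its tangent at the lower band edge, scaled by the threshold
  have hsq : (-1681 / 10000 : ℝ) + 41 / 100 * n ≤ (n / 2) ^ 2 := by nlinarith [sq_nonneg (n - 41 / 50)]
  have hsqU : ((-1681 / 10000 : ℝ) + 41 / 100 * n) * (11 / 2) ≤ (n / 2) ^ 2 * (11 / 2) :=
    mul_le_mul_of_nonneg_right hsq (by norm_num)
  have h8 : (0 : ℝ) ≤ 8 := by norm_num
  have hH := laLow_quarter_cap h498 h8 le_rfl (s := t') (by linarith)
  -- the four kernel Fermi-sea columns at U₀ = 0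
  have ra := fermiSeaTangentRow_tPrime_neg_seven_div_twenty_at_four_div_five (U := 0) le_rfl hn0 hn2'
  have rb := fermiSeaTangentRow_tPrime_neg_three_div_ten_at_twentyone_div_twentyfive (U := 0) le_rfl hn0 hn2'
  have rc := fermiSeaTangentRow_tPrime_neg_one_div_four_at_seventeen_div_twenty (U := 0) le_rfl hn0 hn2'
  have rd := fermiSeaTangentRow_tPrime_neg_one_div_five_at_seventeen_div_twenty (U := 0) le_rfl hn0 hn2'
  rcases le_or_gt t' (-1 / 4) with hp | hp
  · -- far side: the t′-chord cap at `n = 7/8`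
    have hA := objE_conc78_cap8 h445 h473 (s := t') hp
    have hcap := laLow_chord_half_78 (n := n) h8 hH hA hhalf h78
    rcases le_or_gt t' (-3 / 10) with hq | hq
    · -- piece `[-33/100, -3/10]`, columns `-7/20`, `-3/10`
      have hfl := objE_floor_between hn0 hn2' (by norm_num : (-7 / 20 : ℝ) ≤ -3 / 10) ra rb (by linarith) hq
      exact doccN_lt_of_capUc_threshold (U₁ := 11 / 2) (Uc := 8) (by norm_num) (by norm_num) hU hn0 hn2' hcap hfl
        (sub_min_lt_of
          (by nlinarith only [mul_nonneg (sub_nonneg.2 hn1) (sub_nonneg.2 ht1), mul_nonneg (sub_nonneg.2 hn1) (sub_nonneg.2 hq),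
            mul_nonneg (sub_nonneg.2 hn2) (sub_nonneg.2 ht1), mul_nonneg (sub_nonneg.2 hn2) (sub_nonneg.2 hq), hsqU])
          (by nlinarith only [mul_nonneg (sub_nonneg.2 hn1) (sub_nonneg.2 ht1), mul_nonneg (sub_nonneg.2 hn1) (sub_nonneg.2 hq),
            mul_nonneg (sub_nonneg.2 hn2) (sub_nonneg.2 ht1), mul_nonneg (sub_nonneg.2 hn2) (sub_nonneg.2 hq), hsqU]))
    · -- piece `(-3/10, -1/4]`, columns `-3/10`, `-1/4`
      have hfl := objE_floor_between hn0 hn2' (by norm_num : (-3 / 10 : ℝ) ≤ -1 / 4) rb rc hq.le hp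
      exact doccN_lt_of_capUc_threshold (U₁ := 11 / 2) (Uc := 8) (by norm_num) (by norm_num) hU hn0 hn2' hcap hfl
        (sub_min_lt_of
          (by nlinarith only [mul_nonneg (sub_nonneg.2 hn1) (sub_nonneg.2 hq.le), mul_nonneg (sub_nonneg.2 hn1) (sub_nonneg.2 hp),
            mul_nonneg (sub_nonneg.2 hn2) (sub_nonneg.2 hq.le), mul_nonneg (sub_nonneg.2 hn2) (sub_nonneg.2 hp), hsqU])
          (by nlinarith only [mul_nonneg (sub_nonneg.2 hn1) (sub_nonneg.2 hq.le), mul_nonneg (sub_nonneg.2 hn1) (sub_nonneg.2 hp),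
            mul_nonneg (sub_nonneg.2 hn2) (sub_nonneg.2 hq.le), mul_nonneg (sub_nonneg.2 hn2) (sub_nonneg.2 hp), hsqU]))
  · -- near side: kinematic transport of #445
    have hA := laLow_cap78_near h445 h8 le_rfl (s := t') hp.le
    have hcap := laLow_chord_half_78 (n := n) h8 hH hA hhalf h78
    have hfl := objE_floor_between hn0 hn2' (by norm_num : (-1 / 4 : ℝ) ≤ -1 / 5) rc rd hp.le (by linarith)
    exact doccN_lt_of_capUc_threshold (U₁ := 11 / 2) (Uc := 8) (by norm_num) (by norm_num) hU hn0 hn2' hcap hfl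
      (sub_min_lt_of
        (by nlinarith only [mul_nonneg (sub_nonneg.2 hn1) (sub_nonneg.2 hp.le), mul_nonneg (sub_nonneg.2 hn1) (sub_nonneg.2 ht2),
          mul_nonneg (sub_nonneg.2 hn2) (sub_nonneg.2 hp.le), mul_nonneg (sub_nonneg.2 hn2) (sub_nonneg.2 ht2), hsqU])
        (by nlinarith only [mul_nonneg (sub_nonneg.2 hn1) (sub_nonneg.2 hp.le), mul_nonneg (sub_nonneg.2 hn1) (sub_nonneg.2 ht2),
          mul_nonneg (sub_nonneg.2 hn2) (sub_nonneg.2 hp.le), mul_nonneg (sub_nonneg.2 hn2) (sub_nonneg.2 ht2), hsqU]))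

end Summit.Ventures.CertifiedManyBodySolver.Observables

end
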